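/-
Copyright: internal research formalization. Source texts: G. Kempf, F. Knudsen, D. Mumford,
B. Saint-Donat, Toroidal Embeddings I (LNM 339, Springer 1973) [KempfEtAl1973], Ch. II §1 Def. 5
(charts of a conical complex and their compatibility), §2 Thm. 11*; W. Fulton, Introduction to
Toric Varieties [Fulton1993Toric], §2.6 p. 48 (multiplicity of a simplicial cone, Exercise).
-/
import Mathlib
import HarnessLib
import Literature.Geometry.PolyhedralFans.LinkTransport

/-!
# Transport along links, II: the parallelotope count is invariant

Topic: `Literature/Geometry/PolyhedralFans` (sequel of `LinkTransport`). Proofs only, no new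
notions, no named facts. For a link — a linear map `E : ℚ^κ → ℚ^{κ'}` injective on a subspace
`U`, mapping the lattice points of `U` to lattice points and such that every lattice point of
`E U` comes from a lattice point of `U` ([KempfEtAl1973] II §1 Def. 5) — and a finite set of
generators `S ⊆ U`, the lattice points of the half-open parallelotope of `S` correspond
bijectively to those of the parallelotope of `E '' S` (same coefficient vectors). Hence the
parallelotope count `pmult` ([Fulton1993Toric] §2.6 p. 48: the multiplicity of a simplicial cone,
read in either chart) and the cone count `conePMult` are link-invariant, so that the
regularisation measure `(maxPMult, numMax)` of `RegularRefinement.lean` takes the same value on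
linked cones (block A1 of the LINKED-KKMS programme, used by the synchronised multiplicity descent
A5).

* `map_sum_pullback_smul`, `parCoeffs_image_eq` — `parCoeffs S` is the image of `parCoeffs (S.image E)` under the
  pull-back of coefficient vectors `a' ↦ (s ↦ a' (E s))` (extended by `0` off `S`), which is
  injective there;
* `pmult_image` — `pmult (S.image E) = pmult S`;
* `conePMult_map` — `conePMult (σ.map E) = conePMult σ` for a cone `σ ⊆ U` with a primitive
  simplicial generating set.
-/

noncomputable section

namespace Literature.Geometry.PolyhedralFans

open PointedCone Finset

variable {κ κ' : Type*} [DecidableEq (κ → ℚ)] [DecidableEq (κ' → ℚ)]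
variable {E : (κ → ℚ) →ₗ[ℚ] (κ' → ℚ)} {U : Submodule ℚ (κ → ℚ)}

/-- The combination with pulled-back coefficients `s ↦ a' (E s)` (on `S`) is mapped by `E` to the
combination over the image set. [cite: KempfEtAl1973, II §1 Def. 5] -/
theorem map_sum_pullback_smul (hinj : ∀ x ∈ U, E x = 0 → x = 0)
    {S : Finset (κ → ℚ)} (hS : (S : Set (κ → ℚ)) ⊆ U) (a' : (κ' → ℚ) → ℚ) :
    E (∑ s ∈ S, (if s ∈ S then a' (E s) else 0) • s) = ∑ s' ∈ S.image E, a' s' • s' := by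
  rw [map_sum, Finset.sum_image fun x hx y hy h => eq_of_map_eq_of_mem hinj (hS hx) (hS hy) h]
  refine Finset.sum_congr rfl fun s hs => ?_
  rw [map_smul, if_pos hs]

/-- **The parallelotope lattice points correspond under a link.** For `S ⊆ U`, `parCoeffs S` is
exactly the set of pull-backs of the elements of `parCoeffs (S.image E)` (same coefficients on
corresponding generators; the lattice condition is transported by the two lattice hypotheses of
the link). [cite: Fulton1993Toric, §2.6 p. 48] -/
theorem parCoeffs_image_eq (hinj : ∀ x ∈ U, E x = 0 → x = 0)
    (hlat : ∀ x ∈ U, x ∈ latticeN κ → E x ∈ latticeN κ')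
    (hlat' : ∀ y ∈ latticeN κ', y ∈ U.map E → ∃ x ∈ U, x ∈ latticeN κ ∧ E x = y)
    {S : Finset (κ → ℚ)} (hS : (S : Set (κ → ℚ)) ⊆ U) :
    parCoeffs S = (fun a' s => if s ∈ S then a' (E s) else 0) '' parCoeffs (S.image E) := by
  have hspanU : ∀ c : (κ → ℚ) → ℚ, ∑ s ∈ S, c s • s ∈ U := fun c =>
    U.sum_mem fun s hs => U.smul_mem _ (hS (Finset.mem_coe.mpr hs))
  apply le_antisymm
  · -- every parallelotope point of `S` comes from one of `E '' S`
    intro a ha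
    obtain ⟨hb, hz, hN⟩ := ha
    -- push the coefficients forward along `E|S` (injective)
    let a' : (κ' → ℚ) → ℚ := fun s' => if h : ∃ s ∈ S, E s = s' then a h.choose else 0
    have ha'E : ∀ s ∈ S, a' (E s) = a s := by
      intro s hs
      have hex : ∃ t ∈ S, E t = E s := ⟨s, hs, rfl⟩
      have h1 : a' (E s) = a hex.choose := by simp only [a', dif_pos hex]
      rw [h1]
      obtain ⟨ht, hEt⟩ := hex.choose_spec
      rw [eq_of_map_eq_of_mem hinj (hS (Finset.mem_coe.mpr ht)) (hS (Finset.mem_coe.mpr hs)) hEt]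
    refine ⟨a', ⟨fun s' hs' => ?_, fun s' hs' => ?_, ?_⟩, ?_⟩
    · obtain ⟨s, hs, rfl⟩ := Finset.mem_image.mp hs'
      rw [ha'E s hs]; exact hb s hs
    · have hne : ¬ ∃ s ∈ S, E s = s' := fun ⟨s, hs, hEs⟩ =>
        hs' (Finset.mem_image.mpr ⟨s, hs, hEs⟩)
      simp only [a', dif_neg hne]
    · -- lattice condition on the image side
      have hsum : ∑ s' ∈ S.image E, a' s' • s' = E (∑ s ∈ S, a s • s) := by
        rw [map_sum, Finset.sum_image fun x hx y hy h =>
          eq_of_map_eq_of_mem hinj (hS hx) (hS hy) h]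
        exact Finset.sum_congr rfl fun s hs => by rw [map_smul, ha'E s hs]
      rw [hsum]
      exact hlat _ (hspanU a) hN
    · funext s
      dsimp only
      by_cases hs : s ∈ S
      · rw [if_pos hs, ha'E s hs]
      · rw [if_neg hs, hz s hs]
  · -- every pull-back is a parallelotope point of `S`
    rintro _ ⟨a', ⟨hb', hz', hN'⟩, rfl⟩
    refine ⟨fun s hs => ?_, fun s hs => ?_, ?_⟩
    · dsimp only; rw [if_pos hs]; exact hb' (E s) (Finset.mem_image_of_mem E hs)
    · dsimp only; rw [if_neg hs]
    · have hE : E (∑ s ∈ S, (if s ∈ S then a' (E s) else 0) • s) ∈ latticeN κ' := by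
        rw [map_sum_pullback_smul hinj hS]; exact hN'
      exact (map_mem_latticeN_iff hinj hlat hlat' (hspanU _)).mp hE

/-- **The parallelotope count is link-invariant**: `pmult (S.image E) = pmult S` for `S ⊆ U`
([Fulton1993Toric] §2.6 p. 48: the multiplicity of a simplicial lattice cone does not depend on
the chart; [KempfEtAl1973] II §2 Thm. 11*). [cite: Fulton1993Toric, §2.6 p. 48] -/
theorem pmult_image (hinj : ∀ x ∈ U, E x = 0 → x = 0)
    (hlat : ∀ x ∈ U, x ∈ latticeN κ → E x ∈ latticeN κ')
    (hlat' : ∀ y ∈ latticeN κ', y ∈ U.map E → ∃ x ∈ U, x ∈ latticeN κ ∧ E x = y)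
    {S : Finset (κ → ℚ)} (hS : (S : Set (κ → ℚ)) ⊆ U) : pmult (S.image E) = pmult S := by
  rw [pmult, pmult, parCoeffs_image_eq hinj hlat hlat' hS]
  refine (Set.InjOn.ncard_image ?_).symm
  intro a' ha' b' hb' h
  funext s'
  by_cases hs' : s' ∈ S.image E
  · obtain ⟨s, hs, rfl⟩ := Finset.mem_image.mp hs'
    have h1 := congr_fun h s
    dsimp only at h1
    rwa [if_pos hs, if_pos hs] at h1
  · rw [ha'.2.1 s' hs', hb'.2.1 s' hs']

/-- **The cone count is link-invariant**: for a cone `σ ⊆ U` with a primitive simplicial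
generating set, `conePMult (σ.map E) = conePMult σ` — the measure `(maxPMult, numMax)` of the
regularisation takes equal values on linked cones. [cite: KempfEtAl1973, II §2 Thm. 11*] -/
theorem conePMult_map (hinj : ∀ x ∈ U, E x = 0 → x = 0)
    (hlat : ∀ x ∈ U, x ∈ latticeN κ → E x ∈ latticeN κ')
    (hlat' : ∀ y ∈ latticeN κ', y ∈ U.map E → ∃ x ∈ U, x ∈ latticeN κ ∧ E x = y)
    {σ : PointedCone ℚ (κ → ℚ)} {S : Finset (κ → ℚ)} (hσ : (σ : Set (κ → ℚ)) ⊆ U)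
    (h : IsPrimGens σ S) : conePMult (σ.map E) = conePMult σ := by
  have hSU : (S : Set (κ → ℚ)) ⊆ U := fun x hx => hσ (h.2.2 ▸ PointedCone.subset_hull hx)
  rw [conePMult_map_eq_pmult_image hinj hlat hlat' hσ h, conePMult_eq h, pmult_image hinj hlat hlat' hSU]

end Literature.Geometry.PolyhedralFans

end
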